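import Literature.NumberTheory.EllipticCurves.ModularSymbolsSubquotients
import HarnessLib

/-!
# The completion of a coefficient system along an invariant filtration, and its modular symbols

For a coefficient system `A` on a multiplicatively closed `S` (`ModularSymbolsCoefficients`) and a
DECREASING family of `A`-invariant submodules `W 0 ⊇ W 1 ⊇ ⋯` (e.g. Greenberg's filtration
`F^N 𝔻⁰_k` of `PAdicMeasureMomentFiltration`, invariant by `isInvariant_filGInt`) we build the
**completion** `V̂ = lim_N V / W N` as a coefficient system (`hat`): the submodule of compatible
families in `Π_N V / W N` (`hatSub`) with the componentwise quotient action (`piCoeff`, `ModularSymbolsSubquotients.quotientρ`),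
the reduction morphism `V → V̂` (`toHatHom`, injective iff `⋂ W N = 0`) and the projections
`V̂ → V / W N` (`projHom`).  Modular symbols with values in `V̂` are EXACTLY the compatible families of
symbols with values in the `V / W N` (`glueHat`, `proj_glueHat`, `hat_symb_eq_of_forall_proj_eq`) — the
algebraic inverse limit `Symb_Γ(V̂) = lim_N Symb_Γ(V/W N)`, with no analysis.  With `W N = F^N 𝔻⁰_k`
this is the coefficient module `D̂_k` (the `F`-completion of measures inside Greenberg's rigid
distributions `D_k(O)`) in which Greenberg's lifting sequence (`ModularSymbolsGreenbergLifting`)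
converges.

Brick B3e-S3a of the bottom-up plan recorded with the named fact
`greenbergStevens_kitagawa_twoVariable_interpolation_allBranches`.  Everything is proved; no named facts.

## References

* M. Greenberg, Israel J. Math. 161 (2007), §3–4 (the modules `A^N D_k(O)` and their limit). [Greenberg2007Lifting]
-/

noncomputable section

open scoped MatrixGroups
open Matrix

namespace Literature.NumberTheory.EllipticCurves

namespace CoeffActionOn

variable {S : Set (Matrix (Fin 2) (Fin 2) ℤ)} {R V : Type*} [CommRing R] [AddCommGroup V] [Module R V]
  (A : CoeffActionOn S R V) (hS : ∀ M ∈ S, ∀ M' ∈ S, M * M' ∈ S)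
  {W : ℕ → Submodule R V} (hW : ∀ N, A.IsInvariant (W N)) (hanti : Antitone W)

/-! ### The product system and the compatible families -/

/-- The transition maps `V / W N' → V / W N`, `N ≤ N'`. [folklore] -/
def transQ {N N' : ℕ} (h : N ≤ N') : (V ⧸ W N') →ₗ[R] (V ⧸ W N) :=
  Submodule.mapQ (W N') (W N) LinearMap.id (fun v hv => by rw [Submodule.mem_comap, LinearMap.id_apply]; exact hanti h hv)

/-- `transQ` on classes. [folklore] -/
@[simp] theorem transQ_mk {N N' : ℕ} (h : N ≤ N') (v : V) :
    transQ hanti h (Submodule.Quotient.mk v) = Submodule.Quotient.mk v := rfl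

/-- **The coefficient system on `Π_N V / W N`** (componentwise quotient action). [folklore] -/
def piCoeff : CoeffActionOn S R ((N : ℕ) → V ⧸ W N) where
  ρ M := LinearMap.pi fun N => (A.quotientρ (hW N) M).comp (LinearMap.proj N)
  ρ_mul M hM M' hM' := by
    refine LinearMap.ext fun x => funext fun N => ?_
    simp only [LinearMap.pi_apply, LinearMap.comp_apply, LinearMap.proj_apply]
    have h := LinearMap.congr_fun ((A.quotient hS (hW N)).ρ_mul M hM M' hM') (x N)
    simpa only [quotient_ρ, LinearMap.comp_apply] using h
  ρ_one := by
    refine LinearMap.ext fun x => funext fun N => ?_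
    simp only [LinearMap.pi_apply, LinearMap.comp_apply, LinearMap.proj_apply, LinearMap.id_apply]
    have h := LinearMap.congr_fun (A.quotient hS (hW N)).ρ_one (x N)
    simpa only [quotient_ρ, LinearMap.id_apply] using h

/-- The operators of `piCoeff`, componentwise. [folklore] -/
theorem piCoeff_ρ_apply (M : Matrix (Fin 2) (Fin 2) ℤ) (x : (N : ℕ) → V ⧸ W N) (N : ℕ) :
    (A.piCoeff hS hW).ρ M x N = A.quotientρ (hW N) M (x N) := rfl

/-- **The compatible families** `V̂ = lim_N V / W N ⊆ Π_N V / W N`. [cite: Greenberg2007Lifting, §3] -/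
def hatSub : Submodule R ((N : ℕ) → V ⧸ W N) where
  carrier := {x | ∀ (N N' : ℕ) (h : N ≤ N'), transQ hanti h (x N') = x N}
  add_mem' := by
    intro x y hx hy N N' h
    rw [Pi.add_apply, Pi.add_apply, map_add, hx N N' h, hy N N' h]
  zero_mem' := fun N N' h => by simp
  smul_mem' := by
    intro c x hx N N' h
    rw [Pi.smul_apply, Pi.smul_apply, map_smul, hx N N' h]

/-- Membership in `hatSub`. [folklore] -/
theorem mem_hatSub_iff {x : (N : ℕ) → V ⧸ W N} :
    x ∈ hatSub hanti ↔ ∀ (N N' : ℕ) (h : N ≤ N'), transQ hanti h (x N') = x N := Iff.rfl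

/-- The quotient operators commute with the transitions. [folklore] -/
theorem transQ_quotientρ {N N' : ℕ} (h : N ≤ N') {M : Matrix (Fin 2) (Fin 2) ℤ} (hM : M ∈ S) (x : V ⧸ W N') :
    transQ hanti h (A.quotientρ (hW N') M x) = A.quotientρ (hW N) M (transQ hanti h x) := by
  induction x using Submodule.Quotient.induction_on with
  | H v => rw [A.quotientρ_mk (hW N') hM, transQ_mk, transQ_mk, A.quotientρ_mk (hW N) hM]

/-- **`V̂` is invariant** under the product system. [folklore] -/
theorem isInvariant_hatSub : (A.piCoeff hS hW).IsInvariant (hatSub hanti) := by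
  intro M hM x hx
  rw [Submodule.mem_comap, mem_hatSub_iff]
  intro N N' h
  rw [piCoeff_ρ_apply, piCoeff_ρ_apply, A.transQ_quotientρ hW hanti h hM, hx N N' h]

/-- **The completion `V̂ = lim_N V / W N` as a coefficient system.** [cite: Greenberg2007Lifting, §3] -/
def hat : CoeffActionOn S R (hatSub hanti) :=
  (A.piCoeff hS hW).restrict hS (A.isInvariant_hatSub hS hW hanti)

/-- The operators of `hat`, componentwise on `S`. [folklore] -/
theorem hat_ρ_val {M : Matrix (Fin 2) (Fin 2) ℤ} (hM : M ∈ S) (x : hatSub hanti) (N : ℕ) :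
    ((A.hat hS hW hanti).ρ M x).1 N = A.quotientρ (hW N) M (x.1 N) := by
  change ((A.piCoeff hS hW).restrictρ (A.isInvariant_hatSub hS hW hanti) M x : (N : ℕ) → V ⧸ W N) N = _
  rw [(A.piCoeff hS hW).restrictρ_apply _ hM]
  rfl

/-! ### Reduction `V → V̂` and projections `V̂ → V / W N` -/

/-- The diagonal reduction `v ↦ (v mod W N)_N`. [folklore] -/
def toHat : V →ₗ[R] hatSub hanti where
  toFun v := ⟨fun _ => Submodule.Quotient.mk v, fun _ _ _ => rfl⟩
  map_add' _ _ := rfl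
  map_smul' _ _ := rfl

/-- Components of `toHat`. [folklore] -/
@[simp] theorem toHat_val (v : V) (N : ℕ) : (toHat hanti v).1 N = Submodule.Quotient.mk v := rfl

/-- **`V → V̂` is a morphism of coefficient systems.** [folklore] -/
def toHatHom : Hom A (A.hat hS hW hanti) where
  toLinearMap := toHat hanti
  comm M hM v := by
    refine Subtype.ext (funext fun N => ?_)
    rw [toHat_val, A.hat_ρ_val hS hW hanti hM, toHat_val, A.quotientρ_mk (hW N) hM]

/-- `V → V̂` is injective iff the filtration is separated. [folklore] -/
theorem toHat_injective (hsep : ∀ v : V, (∀ N, v ∈ W N) → v = 0) : Function.Injective (toHat (R := R) hanti) := by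
  intro v w h
  rw [← sub_eq_zero]
  refine hsep _ fun N => ?_
  have hN := congrArg (fun x : hatSub hanti => x.1 N) h
  simp only [toHat_val] at hN
  exact (Submodule.Quotient.eq _).mp hN

/-- The projection `V̂ → V / W N`. [folklore] -/
def projHat (N : ℕ) : hatSub hanti →ₗ[R] (V ⧸ W N) where
  toFun x := x.1 N
  map_add' _ _ := rfl
  map_smul' _ _ := rfl

/-- **`V̂ → V / W N` is a morphism of coefficient systems.** [folklore] -/
def projHom (N : ℕ) : Hom (A.hat hS hW hanti) (A.quotient hS (hW N)) where
  toLinearMap := projHat hanti N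
  comm M hM x := by
    change ((A.hat hS hW hanti).ρ M x).1 N = (A.quotient hS (hW N)).ρ M (x.1 N)
    rw [A.hat_ρ_val hS hW hanti hM, quotient_ρ]

/-- Elements of `V̂` with all projections zero are zero. [folklore] -/
theorem hat_eq_zero_of_forall_proj {x : hatSub hanti} (h : ∀ N, x.1 N = 0) : x = 0 :=
  Subtype.ext (funext h)

/-! ### Symbols with values in `V̂` are compatible families of symbols -/

variable {Γ : Subgroup SL(2, ℤ)} (hΓ : ∀ γ : SL(2, ℤ), γ ∈ Γ → (γ : Matrix (Fin 2) (Fin 2) ℤ) ∈ S)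

/-- The `N`-th component of a `V̂`-valued symbol. [folklore] -/
def projSymb (N : ℕ) : (A.hat hS hW hanti).Symb Γ →ₗ[R] (A.quotient hS (hW N)).Symb Γ :=
  mapSymb _ _ (A.projHom hS hW hanti N) hΓ

/-- Components of `projSymb`. [folklore] -/
theorem projSymb_val (N : ℕ) (Φ : (A.hat hS hW hanti).Symb Γ) (x y : P1Q) : (A.projSymb hS hW hanti hΓ N Φ).1 x y = (Φ.1 x y).1 N :=
  rfl

/-- **Two `V̂`-valued symbols with the same components are equal.** [folklore] -/
theorem hat_symb_eq_of_forall_proj_eq {Φ Ψ : (A.hat hS hW hanti).Symb Γ}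
    (h : ∀ N, A.projSymb hS hW hanti hΓ N Φ = A.projSymb hS hW hanti hΓ N Ψ) : Φ = Ψ := by
  refine Subtype.ext (funext fun x => funext fun y => Subtype.ext (funext fun N => ?_))
  have := congrArg (fun Θ : (A.quotient hS (hW N)).Symb Γ => Θ.1 x y) (h N)
  exact this

/-- The components are compatible. [folklore] -/
theorem transQ_projSymb {N N' : ℕ} (h : N ≤ N') (Φ : (A.hat hS hW hanti).Symb Γ) (x y : P1Q) :
    transQ hanti h ((A.projSymb hS hW hanti hΓ N' Φ).1 x y) = (A.projSymb hS hW hanti hΓ N Φ).1 x y :=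
  (Φ.1 x y).2 N N' h

/-- **Gluing a compatible family of symbols** into a `V̂`-valued symbol. [cite: Greenberg2007Lifting, §4] -/
def glueHat (Φs : (N : ℕ) → (A.quotient hS (hW N)).Symb Γ)
    (hcompat : ∀ (N N' : ℕ) (h : N ≤ N') (x y : P1Q), transQ hanti h ((Φs N').1 x y) = (Φs N).1 x y) :
    (A.hat hS hW hanti).Symb Γ :=
  ⟨fun x y => ⟨fun N => (Φs N).1 x y, fun N N' h => hcompat N N' h x y⟩, by
    refine ⟨(mem_modSym_iff (R := R)).mpr fun x y z => Subtype.ext (funext fun N => ?_), fun γ hγ => ?_⟩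
    · change (Φs N).1 x y + (Φs N).1 y z = (Φs N).1 x z
      exact (mem_modSym_iff (R := R)).mp (Φs N).2.1 x y z
    · funext x y
      refine Subtype.ext (funext fun N => ?_)
      rw [slash_apply, A.hat_ρ_val hS hW hanti (hΓ γ hγ)]
      have h := congrFun (congrFun ((Φs N).2.2 γ hγ) x) y
      rw [slash_apply, quotient_ρ] at h
      exact h⟩

/-- **The glued symbol has the prescribed components.** [folklore] -/
theorem projSymb_glueHat (Φs : (N : ℕ) → (A.quotient hS (hW N)).Symb Γ)
    (hcompat : ∀ (N N' : ℕ) (h : N ≤ N') (x y : P1Q), transQ hanti h ((Φs N').1 x y) = (Φs N).1 x y) (N : ℕ) :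
    A.projSymb hS hW hanti hΓ N (A.glueHat hS hW hanti hΓ Φs hcompat) = Φs N :=
  Subtype.ext (funext fun _ => funext fun _ => rfl)

/-- **`projSymb` commutes with the Hecke operators** (both are induced by morphisms of coefficient systems).
[folklore] -/
theorem projSymb_hecke {N₀ q : ℕ} [NeZero q] (hβ : ∀ i : ModularForms.HeckeIdx N₀ q, ModularForms.heckeRep q i.1 ∈ S) (N : ℕ)
    (Φ : P1Q → P1Q → hatSub hanti) :
    (A.projHom hS hW hanti N).mapFun ((A.hat hS hW hanti).hecke N₀ q Φ) =
      (A.quotient hS (hW N)).hecke N₀ q ((A.projHom hS hW hanti N).mapFun Φ) :=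
  (A.projHom hS hW hanti N).mapFun_hecke hβ Φ

end CoeffActionOn

end Literature.NumberTheory.EllipticCurves

end
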